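import Summits.AtomisticToContinuum.Crystallization.Theorems.ExcessDecayLiouvilleHcpLiouvilleBlowdownGalerkin
import Summits.AtomisticToContinuum.Crystallization.Theorems.ExcessDecayLiouvilleHcpLiouvilleBlowdownLinRows

/-!
# `ExcessDecayLiouville.HcpLiouville` (stmt-AtomisticToContinuum-9332), line `Sketch` v4: Galerkin solutions, II — energies

Helper file for sub-goal `blowdown_greenSolve` (H2 of stub `stub_green`) of crux stmt-AtomisticToContinuum-9332
(`Summit.AtomisticToContinuum.Crystallization.Theses.ExcessDecayLiouville.HcpLiouville`), line `Sketch`, skeleton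
v4.  The bilinear pairing `a(u, φ) = Σ'_p ⟪(L u)(p), φ p⟫` of the force-constant operator on finitely supported fields
is SYMMETRIC (`bilin_symm`: Fubini for the absolutely summable double family and the symmetry / evenness of the
force-constant matrix `K(e)` from `…BlowdownLinRows`), whence the monotone-energy inequalities of the Galerkin solutions `u_V`
(`u_V` supported on the finite set `V` of sites, `(L u_V)(p) = f p` on `V`): with `E_V = Σ'⟪f, u_V⟫`,
`κ · nnForm u_V ≤ E_V`, and for `V ⊆ W`, `κ · nnForm (u_W − u_V) ≤ E_W − E_V` (so `E_V ≤ E_W`); an admissible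
right-hand side (`|Σ'⟪f, w⟫| ≤ N √(nnForm w)`) gives `nnForm u_V ≤ (N/κ)²`, `E_V ≤ N²/κ`.
All `[folklore]`; a `--supports` helper, nothing here closes an item.
-/

noncomputable section

namespace Summit.AtomisticToContinuum.Crystallization.Theorems.ExcessDecayLiouville

open scoped BigOperators Topology Classical InnerProductSpace RealInnerProductSpace
open Literature.MathematicalPhysics.StatisticalMechanics
open Summit.AtomisticToContinuum.Crystallization.Theses.ExcessDecayLiouville
open Summit.AtomisticToContinuum.Crystallization.Theorems.PhononStabilityNegative

section

variable {t : Fin 2 → EuclideanSpace ℝ (Fin 3)} {A : EuclideanSpace ℝ (Fin 3) →L[ℝ] EuclideanSpace ℝ (Fin 3)}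

/-! ## The double family `⟪K(p − q)(u p − u q), φ p⟫` and the symmetry of the pairing -/

/-- The double family `(p, q) ↦ ⟪K(p − q)(u p − u q), φ p⟫` is absolutely summable on `S × S` for finitely supported
`u, φ` (finitely many nonzero rows, each summable). [folklore] -/
theorem summable_pairFamily₂ (hA : Adm₀ A) (hI : Inner₀ t A)
    {u φ : EuclideanSpace ℝ (Fin 3) → EuclideanSpace ℝ (Fin 3)} (hu : (Function.support u).Finite)
    (hφ : (Function.support φ).Finite) :
    Summable (fun pq : Sites₀ t A × Sites₀ t A =>
      ⟪forceConst ((pq.1 : EuclideanSpace ℝ (Fin 3)) - pq.2) (u pq.1 - u pq.2), φ pq.1⟫) := by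
  have h := flatDiff_summable_uncurry_of_left_finset
    (fun p q : Sites₀ t A => ⟪forceConst ((p : EuclideanSpace ℝ (Fin 3)) - q) (u p - u q), φ p⟫)
    (finite_support_sites (t := t) (A := A) hφ).toFinset ?_ ?_
  · exact h
  · intro p hp q
    have : φ p = 0 := by
      by_contra h'
      exact hp ((Set.Finite.mem_toFinset _).2 h')
    simp [this]
  · intro p _
    refine ((summable_forceConst_row hA hI hu p).mapL (innerSL ℝ (φ p))).congr fun q => ?_
    simp only [innerSL_apply_apply]
    exact real_inner_comm _ _

/-- The pairing as a double sum: `Σ'_p ⟪(L u)(p), φ p⟫ = Σ'_{(p,q)} ⟪K(p − q)(u p − u q), φ p⟫`. [folklore] -/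
theorem bilin_eq_tsum_prod (hA : Adm₀ A) (hI : Inner₀ t A)
    {u φ : EuclideanSpace ℝ (Fin 3) → EuclideanSpace ℝ (Fin 3)} (hu : (Function.support u).Finite)
    (hφ : (Function.support φ).Finite) :
    ∑' p : Sites₀ t A, ⟪∑' q : Sites₀ t A, forceConst ((p : EuclideanSpace ℝ (Fin 3)) - q) (u p - u q), φ p⟫ =
      ∑' pq : Sites₀ t A × Sites₀ t A,
        ⟪forceConst ((pq.1 : EuclideanSpace ℝ (Fin 3)) - pq.2) (u pq.1 - u pq.2), φ pq.1⟫ := by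
  have hG := summable_pairFamily₂ hA hI hu hφ
  rw [hG.tsum_prod' (fun p => hG.prod_factor p)]
  refine tsum_congr fun p => ?_
  rw [real_inner_comm, ← innerSL_apply_apply (𝕜 := ℝ),
    ContinuousLinearMap.map_tsum (innerSL ℝ (φ p)) (summable_forceConst_row hA hI hu p)]
  refine tsum_congr fun q => ?_
  rw [innerSL_apply_apply, real_inner_comm]

/-- Symmetrisation: `2 Σ'_p ⟪(L u)(p), φ p⟫ = Σ'_{(p,q)} ⟪K(p − q)(u p − u q), φ p − φ q⟫`. [folklore] -/
theorem two_mul_bilin_eq (hA : Adm₀ A) (hI : Inner₀ t A)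
    {u φ : EuclideanSpace ℝ (Fin 3) → EuclideanSpace ℝ (Fin 3)} (hu : (Function.support u).Finite)
    (hφ : (Function.support φ).Finite) :
    2 * ∑' p : Sites₀ t A, ⟪∑' q : Sites₀ t A, forceConst ((p : EuclideanSpace ℝ (Fin 3)) - q) (u p - u q), φ p⟫ =
      ∑' pq : Sites₀ t A × Sites₀ t A,
        ⟪forceConst ((pq.1 : EuclideanSpace ℝ (Fin 3)) - pq.2) (u pq.1 - u pq.2), φ pq.1 - φ pq.2⟫ := by
  have hG := summable_pairFamily₂ hA hI hu hφ
  rw [bilin_eq_tsum_prod hA hI hu hφ, two_mul]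
  have hswap : ∑' pq : Sites₀ t A × Sites₀ t A,
      ⟪forceConst ((pq.1 : EuclideanSpace ℝ (Fin 3)) - pq.2) (u pq.1 - u pq.2), φ pq.1⟫ =
      ∑' pq : Sites₀ t A × Sites₀ t A,
        ⟪forceConst ((pq.2 : EuclideanSpace ℝ (Fin 3)) - pq.1) (u pq.2 - u pq.1), φ pq.2⟫ := by
    rw [← (Equiv.prodComm (Sites₀ t A) (Sites₀ t A)).tsum_eq]
    rfl
  have hG2 : Summable (fun pq : Sites₀ t A × Sites₀ t A =>
      ⟪forceConst ((pq.2 : EuclideanSpace ℝ (Fin 3)) - pq.1) (u pq.2 - u pq.1), φ pq.2⟫) := by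
    have := (Equiv.prodComm (Sites₀ t A) (Sites₀ t A)).summable_iff.2 hG
    exact this
  nth_rewrite 1 [hswap]
  rw [← hG2.tsum_add hG]
  refine tsum_congr fun pq => ?_
  obtain ⟨p, q⟩ := pq
  simp only
  rw [show (q : EuclideanSpace ℝ (Fin 3)) - p = -((p : EuclideanSpace ℝ (Fin 3)) - q) by abel,
    Blowdown.forceConst_neg, show u q - u p = -(u p - u q) by abel, map_neg, inner_neg_left, inner_sub_right]
  ring

/-- **Symmetry of the pairing**: `Σ'_p ⟪(L u)(p), φ p⟫ = Σ'_p ⟪(L φ)(p), u p⟫` for finitely supported `u, φ`.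
[folklore] -/
theorem bilin_symm (hA : Adm₀ A) (hI : Inner₀ t A)
    {u φ : EuclideanSpace ℝ (Fin 3) → EuclideanSpace ℝ (Fin 3)} (hu : (Function.support u).Finite)
    (hφ : (Function.support φ).Finite) :
    ∑' p : Sites₀ t A, ⟪∑' q : Sites₀ t A, forceConst ((p : EuclideanSpace ℝ (Fin 3)) - q) (u p - u q), φ p⟫ =
      ∑' p : Sites₀ t A, ⟪∑' q : Sites₀ t A, forceConst ((p : EuclideanSpace ℝ (Fin 3)) - q) (φ p - φ q), u p⟫ := by
  have h1 := two_mul_bilin_eq hA hI hu hφ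
  have h2 := two_mul_bilin_eq hA hI hφ hu
  have h3 : ∑' pq : Sites₀ t A × Sites₀ t A,
      ⟪forceConst ((pq.1 : EuclideanSpace ℝ (Fin 3)) - pq.2) (u pq.1 - u pq.2), φ pq.1 - φ pq.2⟫ =
      ∑' pq : Sites₀ t A × Sites₀ t A,
        ⟪forceConst ((pq.1 : EuclideanSpace ℝ (Fin 3)) - pq.2) (φ pq.1 - φ pq.2), u pq.1 - u pq.2⟫ :=
    tsum_congr fun pq => Blowdown.inner_forceConst_comm _ _ _
  linarith

/-! ## Energies of the Galerkin solutions -/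

/-- The `p`-family `⟪(L u)(p), φ p⟫` is finitely supported in `p` when `φ` is supported on a finite set of sites,
hence summable. [folklore] -/
theorem summable_inner_row {V : Finset (Sites₀ t A)} (g : Sites₀ t A → EuclideanSpace ℝ (Fin 3))
    {φ : EuclideanSpace ℝ (Fin 3) → EuclideanSpace ℝ (Fin 3)}
    (hφ : Function.support φ ⊆ Subtype.val '' (V : Set (Sites₀ t A))) :
    Summable (fun p : Sites₀ t A => ⟪g p, φ p⟫) := by
  refine summable_of_ne_finset_zero (s := V) fun p hp => ?_
  rw [eq_zero_of_not_mem_of_subset_image hφ hp, inner_zero_right]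

/-- **Work equals energy**: if `u` solves `(L u)(p) = f p` on `V` and `φ` is supported on `V' ⊆ V`, then
`⟪(L u)(p), φ p⟫ = ⟪f p, φ p⟫` for every site `p`. [folklore] -/
theorem inner_row_eq_inner_rhs {V V' : Finset (Sites₀ t A)} (hV : V' ⊆ V)
    {f u φ : EuclideanSpace ℝ (Fin 3) → EuclideanSpace ℝ (Fin 3)}
    (hru : ∀ p : Sites₀ t A, p ∈ V →
      ∑' q : Sites₀ t A, forceConst ((p : EuclideanSpace ℝ (Fin 3)) - q) (u p - u q) = f p)
    (hφ : Function.support φ ⊆ Subtype.val '' (V' : Set (Sites₀ t A))) (p : Sites₀ t A) :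
    ⟪∑' q : Sites₀ t A, forceConst ((p : EuclideanSpace ℝ (Fin 3)) - q) (u p - u q), φ p⟫ = ⟪f p, φ p⟫ := by
  by_cases hp : p ∈ V'
  · rw [hru p (hV hp)]
  · rw [eq_zero_of_not_mem_of_subset_image hφ hp, inner_zero_right, inner_zero_right]

/-- **Coercivity at the finite level**: `κ · nnForm u_V ≤ E_V = Σ'⟪f, u_V⟫`. [folklore] -/
theorem mul_nnForm_le_energy (hA : Adm₀ A) (hI : Inner₀ t A) {κ : ℝ} (hPS : Blowdown.PSIneq κ t A)
    {V : Finset (Sites₀ t A)} {f u : EuclideanSpace ℝ (Fin 3) → EuclideanSpace ℝ (Fin 3)}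
    (hu : Function.support u ⊆ Subtype.val '' (V : Set (Sites₀ t A)))
    (hru : ∀ p : Sites₀ t A, p ∈ V →
      ∑' q : Sites₀ t A, forceConst ((p : EuclideanSpace ℝ (Fin 3)) - q) (u p - u q) = f p) :
    κ * nnForm t A u ≤ ∑' p : Sites₀ t A, ⟪f p, u p⟫ := by
  have h := coercive_of_psIneq' hA hI hPS (finite_support_of_subset_image hu) (support_subset_sites_of_subset_image hu)
  rw [tsum_congr fun p => inner_row_eq_inner_rhs (subset_refl V) hru hu p] at h
  exact h

/-- **Monotone energies**: for `V ⊆ W`, `κ · nnForm (u_W − u_V) ≤ E_W − E_V`. [folklore] -/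
theorem mul_nnForm_sub_le_energy_sub (hA : Adm₀ A) (hI : Inner₀ t A) {κ : ℝ} (hPS : Blowdown.PSIneq κ t A)
    {V W : Finset (Sites₀ t A)} (hVW : V ⊆ W) {f u w : EuclideanSpace ℝ (Fin 3) → EuclideanSpace ℝ (Fin 3)}
    (hu : Function.support u ⊆ Subtype.val '' (V : Set (Sites₀ t A)))
    (hru : ∀ p : Sites₀ t A, p ∈ V →
      ∑' q : Sites₀ t A, forceConst ((p : EuclideanSpace ℝ (Fin 3)) - q) (u p - u q) = f p)
    (hw : Function.support w ⊆ Subtype.val '' (W : Set (Sites₀ t A)))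
    (hrw : ∀ p : Sites₀ t A, p ∈ W →
      ∑' q : Sites₀ t A, forceConst ((p : EuclideanSpace ℝ (Fin 3)) - q) (w p - w q) = f p) :
    κ * nnForm t A (fun x => w x - u x) ≤ ∑' p : Sites₀ t A, ⟪f p, w p⟫ - ∑' p : Sites₀ t A, ⟪f p, u p⟫ := by
  have hfu := finite_support_of_subset_image hu
  have hfw := finite_support_of_subset_image hw
  have hd : Function.support (fun x => w x - u x) ⊆ Subtype.val '' (W : Set (Sites₀ t A)) := by
    intro x hx
    by_contra hx'
    have h1 : w x = 0 := by
      by_contra h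
      exact hx' (hw h)
    have h2 : u x = 0 := by
      by_contra h
      exact hx' ((Set.image_mono (Finset.coe_subset.2 hVW)) (hu h))
    exact hx (by simp [h1, h2])
  have h := coercive_of_psIneq' hA hI hPS (finite_support_of_subset_image hd) (support_subset_sites_of_subset_image hd)
  refine h.trans (le_of_eq ?_)
  -- split the work of the difference into four pairings
  have hrow : ∀ p : Sites₀ t A,
      ∑' q : Sites₀ t A, forceConst ((p : EuclideanSpace ℝ (Fin 3)) - q) ((w p - u p) - (w q - u q)) =
      ∑' q : Sites₀ t A, forceConst ((p : EuclideanSpace ℝ (Fin 3)) - q) (w p - w q) -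
        ∑' q : Sites₀ t A, forceConst ((p : EuclideanSpace ℝ (Fin 3)) - q) (u p - u q) :=
    fun p => forceConst_row_sub hA hI hfw hfu p
  have hsplit : ∀ p : Sites₀ t A,
      ⟪∑' q : Sites₀ t A, forceConst ((p : EuclideanSpace ℝ (Fin 3)) - q) ((w p - u p) - (w q - u q)), w p - u p⟫ =
      (⟪∑' q : Sites₀ t A, forceConst ((p : EuclideanSpace ℝ (Fin 3)) - q) (w p - w q), w p⟫ -
        ⟪∑' q : Sites₀ t A, forceConst ((p : EuclideanSpace ℝ (Fin 3)) - q) (w p - w q), u p⟫) -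
      (⟪∑' q : Sites₀ t A, forceConst ((p : EuclideanSpace ℝ (Fin 3)) - q) (u p - u q), w p⟫ -
        ⟪∑' q : Sites₀ t A, forceConst ((p : EuclideanSpace ℝ (Fin 3)) - q) (u p - u q), u p⟫) := by
    intro p
    rw [hrow p, inner_sub_left, inner_sub_right, inner_sub_right]
  rw [tsum_congr hsplit]
  have s1 := summable_inner_row (fun p : Sites₀ t A =>
    ∑' q : Sites₀ t A, forceConst ((p : EuclideanSpace ℝ (Fin 3)) - q) (w p - w q)) hw
  have s2 := summable_inner_row (fun p : Sites₀ t A =>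
    ∑' q : Sites₀ t A, forceConst ((p : EuclideanSpace ℝ (Fin 3)) - q) (w p - w q)) hu
  have s3 := summable_inner_row (fun p : Sites₀ t A =>
    ∑' q : Sites₀ t A, forceConst ((p : EuclideanSpace ℝ (Fin 3)) - q) (u p - u q)) hw
  have s4 := summable_inner_row (fun p : Sites₀ t A =>
    ∑' q : Sites₀ t A, forceConst ((p : EuclideanSpace ℝ (Fin 3)) - q) (u p - u q)) hu
  rw [(s1.sub s2).tsum_sub (s3.sub s4), s1.tsum_sub s2, s3.tsum_sub s4]
  -- evaluate the four pairings
  have e1 : ∑' p : Sites₀ t A, ⟪∑' q : Sites₀ t A, forceConst ((p : EuclideanSpace ℝ (Fin 3)) - q) (w p - w q), w p⟫ =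
      ∑' p : Sites₀ t A, ⟪f p, w p⟫ := tsum_congr fun p => inner_row_eq_inner_rhs (subset_refl W) hrw hw p
  have e2 : ∑' p : Sites₀ t A, ⟪∑' q : Sites₀ t A, forceConst ((p : EuclideanSpace ℝ (Fin 3)) - q) (w p - w q), u p⟫ =
      ∑' p : Sites₀ t A, ⟪f p, u p⟫ := tsum_congr fun p => inner_row_eq_inner_rhs hVW hrw hu p
  have e3 : ∑' p : Sites₀ t A, ⟪∑' q : Sites₀ t A, forceConst ((p : EuclideanSpace ℝ (Fin 3)) - q) (u p - u q), w p⟫ =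
      ∑' p : Sites₀ t A, ⟪f p, u p⟫ := by
    rw [bilin_symm hA hI hfu hfw]
    exact e2
  have e4 : ∑' p : Sites₀ t A, ⟪∑' q : Sites₀ t A, forceConst ((p : EuclideanSpace ℝ (Fin 3)) - q) (u p - u q), u p⟫ =
      ∑' p : Sites₀ t A, ⟪f p, u p⟫ := tsum_congr fun p => inner_row_eq_inner_rhs (subset_refl V) hru hu p
  rw [e1, e2, e3, e4]
  ring

/-- **Energies increase with the set**: for `V ⊆ W`, `E_V ≤ E_W`. [folklore] -/
theorem energy_mono (hA : Adm₀ A) (hI : Inner₀ t A) {κ : ℝ} (hκ : 0 < κ) (hPS : Blowdown.PSIneq κ t A)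
    {V W : Finset (Sites₀ t A)} (hVW : V ⊆ W) {f u w : EuclideanSpace ℝ (Fin 3) → EuclideanSpace ℝ (Fin 3)}
    (hu : Function.support u ⊆ Subtype.val '' (V : Set (Sites₀ t A)))
    (hru : ∀ p : Sites₀ t A, p ∈ V →
      ∑' q : Sites₀ t A, forceConst ((p : EuclideanSpace ℝ (Fin 3)) - q) (u p - u q) = f p)
    (hw : Function.support w ⊆ Subtype.val '' (W : Set (Sites₀ t A)))
    (hrw : ∀ p : Sites₀ t A, p ∈ W →
      ∑' q : Sites₀ t A, forceConst ((p : EuclideanSpace ℝ (Fin 3)) - q) (w p - w q) = f p) :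
    ∑' p : Sites₀ t A, ⟪f p, u p⟫ ≤ ∑' p : Sites₀ t A, ⟪f p, w p⟫ := by
  have h := mul_nnForm_sub_le_energy_sub hA hI hPS hVW hu hru hw hrw
  have h0 : 0 ≤ κ * nnForm t A (fun x => w x - u x) := mul_nonneg hκ.le (nnForm_nonneg _ _ _)
  linarith

/-- **Bounded energies**: an admissible right-hand side (`|Σ'⟪f, v⟫| ≤ N √(nnForm v)` on finitely supported `v`)
gives `√(nnForm u_V) ≤ N / κ`, `nnForm u_V ≤ (N / κ)²` and `0 ≤ E_V ≤ N² / κ`. [folklore] -/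
theorem energy_bounds (hA : Adm₀ A) (hI : Inner₀ t A) {κ : ℝ} (hκ : 0 < κ) (hPS : Blowdown.PSIneq κ t A)
    {V : Finset (Sites₀ t A)} {f u : EuclideanSpace ℝ (Fin 3) → EuclideanSpace ℝ (Fin 3)} {N : ℝ} (hN : 0 ≤ N)
    (hf : ∀ w : EuclideanSpace ℝ (Fin 3) → EuclideanSpace ℝ (Fin 3), (Function.support w).Finite →
      Function.support w ⊆ Sites₀ t A → |∑' p : Sites₀ t A, ⟪f p, w p⟫| ≤ N * Real.sqrt (nnForm t A w))
    (hu : Function.support u ⊆ Subtype.val '' (V : Set (Sites₀ t A)))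
    (hru : ∀ p : Sites₀ t A, p ∈ V →
      ∑' q : Sites₀ t A, forceConst ((p : EuclideanSpace ℝ (Fin 3)) - q) (u p - u q) = f p) :
    Real.sqrt (nnForm t A u) ≤ N / κ ∧ nnForm t A u ≤ (N / κ) ^ 2 ∧
      0 ≤ ∑' p : Sites₀ t A, ⟪f p, u p⟫ ∧ ∑' p : Sites₀ t A, ⟪f p, u p⟫ ≤ N ^ 2 / κ := by
  have hco := mul_nnForm_le_energy hA hI hPS hu hru
  have hadm := hf u (finite_support_of_subset_image hu) (support_subset_sites_of_subset_image hu)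
  have hE := le_abs_self (∑' p : Sites₀ t A, ⟪f p, u p⟫)
  set X := Real.sqrt (nnForm t A u) with hX
  have hX0 : 0 ≤ X := Real.sqrt_nonneg _
  have hXsq : nnForm t A u = X ^ 2 := by rw [hX, Real.sq_sqrt (nnForm_nonneg _ _ _)]
  rw [hXsq] at hco
  have h1 : X ≤ N / κ := by
    rw [le_div_iff₀ hκ]
    rcases hX0.lt_or_eq with hpos | hzero
    · nlinarith
    · rw [← hzero, zero_mul]; exact hN
  have h0 : 0 ≤ ∑' p : Sites₀ t A, ⟪f p, u p⟫ := le_trans (by positivity) hco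
  refine ⟨h1, ?_, h0, ?_⟩
  · rw [hXsq]
    exact pow_le_pow_left₀ hX0 h1 2
  · calc ∑' p : Sites₀ t A, ⟪f p, u p⟫ ≤ N * X := hE.trans hadm
      _ ≤ N * (N / κ) := mul_le_mul_of_nonneg_left h1 hN
      _ = N ^ 2 / κ := by ring

end

/-- Registered helper of sub-goal `blowdown_greenSolve` (H2 of stub `stub_green`, crux stmt-AtomisticToContinuum-9332,
line `Sketch` v4): symmetry of the pairing of the force-constant operator on finitely supported fields. [folklore] -/
theorem blowdown_galerkinEnergy : ∀ (t : Fin 2 → (EuclideanSpace ℝ (Fin 3))) (A : (EuclideanSpace ℝ (Fin 3)) →L[ℝ] (EuclideanSpace ℝ (Fin 3))), Adm₀ A → Inner₀ t A → ∀ u φ : (EuclideanSpace ℝ (Fin 3)) → (EuclideanSpace ℝ (Fin 3)), (Function.support u).Finite → (Function.support φ).Finite → ∑' p : Sites₀ t A, ⟪∑' q : Sites₀ t A, forceConst ((p : (EuclideanSpace ℝ (Fin 3))) - q) (u p - u q), φ p⟫_ℝ = ∑' p : Sites₀ t A, ⟪∑' q : Sites₀ t A, forceConst ((p : (EuclideanSpace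 ℝ (Fin 3))) - q) (φ p - φ q), u p⟫_ℝ :=
  fun _ _ hA hI _ _ hu hφ => bilin_symm hA hI hu hφ

end Summit.AtomisticToContinuum.Crystallization.Theorems.ExcessDecayLiouville

end
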